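import Summits.ResolutionOfSingularities.ResolutionOfSingularities.Theorems.FrobeniusLadderFInjectiveMacaulayficationDominatingLocFixLocal
import Literature.AlgebraicGeometry.Resolution.AffineBlowupUnique
import Literature.AlgebraicGeometry.Resolution.GermsOfClosedSubsets
import Literature.AlgebraicGeometry.Resolution.SncStrata
import Literature.AlgebraicGeometry.Resolution.StalkSpecializesLocalization
import HarnessLib

/-!
# The 𝔪_η-PRIMARY REGULAR local blow-up at an ISOLATED-SINGULARITY germ of dimension three
# (crux `FInjectiveMacaulayfication` stmt-ResolutionOfSingularities-15315, chain w45a; res-L1-w45a-plan-1 RULING R16.47 (2), first half of the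
# rung supply «FC″ at isolated-singularity curve germs» = the (b3)-supported local datum in the case `J₀ = ⊤`; seat res-L1-w45a-lead-1 g7)

[OURS · L1 W4.5a] Support file (`--supports stmt-ResolutionOfSingularities-15315 --as helper`); replaces the role of NO printed item — hole-#3
bookkeeping of OURS; NOT a statement of the manuscript; def-free; THEOREMS modulo printed results taken BY NAME as hypotheses
(`CossartPiltant2019General` = CP 2019 Thm. 1.1 (i)(ii); `Stacks081R` = Raynaud–Gruson 1971 Thm. 5.2.2; `CossartPiltant2019Principalization` =
CP 2019 Prop. 4.4); AI-written (AI review is weaker than expert review).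

* §1 `isRegularLocalRing_atPrime_of_generizations`: if every PROPER GENERIZATION of `t ∈ X` has a regular local ring then `(𝒪_{X,t})_𝔮` is
  regular for every prime `𝔮 ≠ 𝔪_t` (Stacks 01J7: `𝔮` is the prime of the generization `η_𝔮 ⤳ t`, whose local ring is the localisation of
  `𝒪_{X,t}` at `𝔮` — `isLocalizationAtPrime_stalkSpecializes`, `primeOfSpecializes_fromSpecStalk`).
* §2 `exists_primaryRegularLocFix_of_isolated (hG h081R hP)`: `X₁` an integral `k`-scheme locally of finite type (`char k = p`), `η ∈ X₁` with
  `dim 𝒪_{X₁,η} = 3`, `𝒪_{X₁,η}` NOT regular, `(𝒪_{X₁,η})_𝔮` regular for all `𝔮 ≠ 𝔪_η`. Then there are germs `c′` with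
  `0 ≠ (c′) ⊆ 𝔪_η ⊆ √(c′)` (an `𝔪_η`-PRIMARY centre) ALL of whose affine blow-up charts `𝒪_η[(c′)/c′_j]` are REGULAR and FULL at every prime.
  PROOF: `S := Spec 𝒪_{X₁,η}` is integral, Noetherian, affine, quasi-excellent (`Stacks07QW_field_holds`, `Stacks07QU_holds`) of dimension `3`;
  the tree's one-blowing-up resolution `CP2019.exists_isBlowup_isRegular_of_dim_three_of_isQuasiExcellent` is `ρ : T = Bl_𝓛 S → S`, `T`
  regular, `𝓛 ≠ 0` SUPPORTED OFF `Reg S`; every point of `S` other than the closed point is regular (§1 and `𝒪_{S,x} = (𝒪_η)_x`), so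
  `supp 𝓛 ⊆ {𝔪_η}`; `𝔪_η ∈ supp 𝓛`, for otherwise `𝓛 = ⊤`, `ρ` is an isomorphism (`isBlowup_id_top`, `IsBlowup.unique`) and `S`, hence
  `𝒪_η = 𝒪_{S,𝔪}` (`IsLocalization.atUnits`), would be regular; so `𝓛 = 𝔮~` with `0 ≠ 𝔮 ⊆ 𝔪_η ⊆ √𝔮`
  (`affineBlowup.support_idealSheaf`, `Ideal.radical_eq_sInf`); `Bl_{(c′)} S` for generators `c′` of `𝔮` is a blowing up along `𝓛`, hence
  regular, and a prime `𝔔` of the chart `𝒪_η[(c′)/c′_j]` is a point of the Rees chart (`reesChartEquiv`, `affineBlowup.chartι`) whose local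
  ring is `(𝒪_η[(c′)/c′_j])_𝔔` — regular ⇒ FULL (`FiClauseOfRegular`) — VERBATIM the transfer of res-L1-w45a-stub-1's
  `DominatingLocFixLocal.exists_productCompatible_locFix_dimThree` (p577023). `…_of_isolated'` takes the hypothesis at the proper generizations
  of `η` in `X₁` (res-L1-w45a-tri-2 note (α)).
[cite: CossartPiltant2019, Thm. 1.1 (i)(ii); Prop. 4.4] [cite: RaynaudGruson1971, Thm. 5.2.2] [cite: StacksProject, Tag 01J7; Tag 0804; Tag 080A]
[cite: Matsumura1987, Thm. 17.4] [cite: Kunz1969, Thm. 2.1]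
-/

-- single-problem summit: the doubled namespace component is forced
set_option linter.dupNamespace false

noncomputable section

namespace Summit.ResolutionOfSingularities.ResolutionOfSingularities.Theorems.FInjectiveMacaulayfication.PrimaryRegularLocFixOfIsolated

open CategoryTheory CategoryTheory.Limits AlgebraicGeometry TopologicalSpace IsLocalRing
open Literature.AlgebraicGeometry.Resolution Literature.AlgebraicGeometry.CossartPiltant200819
open Scheme.IdealSheafData
open Summit.ResolutionOfSingularities.ResolutionOfSingularities.Theorems.FInjectiveMacaulayfication
open SliceableCentre FCUnguardedAprime

/-! ## §1 Regular proper generizations ⇒ the punctured spectrum of `𝒪_{X,t}` is regular (Stacks 01J7) -/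

/-- If every proper generization of `t` has a regular local ring, then `(𝒪_{X,t})_𝔮` is regular for every prime `𝔮 ≠ 𝔪_t`: `𝔮` is the prime
of the generization `η_𝔮 ⤳ t`, whose local ring is the localisation of `𝒪_{X,t}` at `𝔮`. [folklore; cite: StacksProject, Tag 01J7] -/
theorem isRegularLocalRing_atPrime_of_generizations {X : Scheme.{0}} (t : X)
    (hreg : ∀ x : X, x ⤳ t → x ≠ t → IsRegularLocalRing (X.presheaf.stalk x))
    (q : PrimeSpectrum (X.presheaf.stalk t)) (hq : q.asIdeal ≠ maximalIdeal (X.presheaf.stalk t)) :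
    IsRegularLocalRing (Localization.AtPrime q.asIdeal) := by
  have h : X.fromSpecStalk t q ⤳ t := fromSpecStalk_specializes q
  have hne : X.fromSpecStalk t q ≠ t := by
    intro heq
    apply hq
    have heq' : X.fromSpecStalk t q = X.fromSpecStalk t (closedPoint (X.presheaf.stalk t)) := by
      rw [heq, Scheme.fromSpecStalk_closedPoint]
    have hinj := (X.fromSpecStalk t).isEmbedding.injective heq'
    rw [hinj]
    rfl
  haveI : IsRegularLocalRing (X.presheaf.stalk (X.fromSpecStalk t q)) := hreg _ h hne
  letI := (X.presheaf.stalkSpecializes h).hom.toAlgebra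
  have hP : (maximalIdeal (X.presheaf.stalk (X.fromSpecStalk t q))).comap (X.presheaf.stalkSpecializes h).hom = q.asIdeal :=
    primeOfSpecializes_fromSpecStalk q
  have hM : ((maximalIdeal (X.presheaf.stalk (X.fromSpecStalk t q))).comap (X.presheaf.stalkSpecializes h).hom).primeCompl =
      q.asIdeal.primeCompl := by
    ext a
    change a ∉ _ ↔ a ∉ _
    rw [hP]
  haveI : IsLocalization.AtPrime (X.presheaf.stalk (X.fromSpecStalk t q)) q.asIdeal := by
    have key := isLocalizationAtPrime_stalkSpecializes h
    change IsLocalization _ _ at key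
    change IsLocalization _ _
    rw [← hM]
    exact key
  exact IsRegularLocalRing.of_ringEquiv
    (IsLocalization.algEquiv q.asIdeal.primeCompl (X.presheaf.stalk (X.fromSpecStalk t q)) (Localization.AtPrime q.asIdeal)).toRingEquiv

/-! ## §2 The 𝔪_η-PRIMARY REGULAR local blow-up at an isolated-singularity germ of dimension three -/

set_option maxHeartbeats 800000 in
-- instance unification on the Rees chart ring `chartRing c' j` is slow (as in `DominatingLocFixLocal.lean`)
/-- **The 𝔪_η-primary regular local blow-up at an isolated-singularity germ of dimension three.** For `η ∈ X₁` with `dim 𝒪_{X₁,η} = 3`,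
`𝒪_{X₁,η}` NOT regular and `(𝒪_{X₁,η})_𝔮` regular for every prime `𝔮 ≠ 𝔪_η`, there are germs `c′` with `0 ≠ (c′) ⊆ 𝔪_η ⊆ √(c′)` all of whose
affine blow-up charts `𝒪_η[(c′)/c′_j]` are REGULAR and FULL at EVERY prime — modulo CP 2019 Thm. 1.1, Raynaud–Gruson flattening and CP 2019
Prop. 4.4 BY NAME (the one-blowing-up resolution is supported off `Reg (Spec 𝒪_η) ⊇` the punctured spectrum). [OURS · conditional-result]
[cite: CossartPiltant2019, Thm. 1.1 (i)(ii); Prop. 4.4] [cite: StacksProject, Tag 0804] -/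
theorem exists_primaryRegularLocFix_of_isolated
    (hG : CossartPiltant2019General.{0}) (h081R : Stacks081R.{0}) (hP : CossartPiltant2019Principalization.{0})
    (p : ℕ) [hp : Fact p.Prime] {k : Type} [Field k] [CharP k p] {X₁ : Scheme.{0}} (f₁ : X₁ ⟶ Spec (.of k))
    [LocallyOfFiniteType f₁] [IsIntegral X₁]
    (η : X₁) (hdim : ringKrullDim (X₁.presheaf.stalk η) = 3) (hsing : ¬ IsRegularLocalRing (X₁.presheaf.stalk η))
    (hreg : ∀ 𝔮 : PrimeSpectrum (X₁.presheaf.stalk η), 𝔮.asIdeal ≠ maximalIdeal (X₁.presheaf.stalk η) →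
      IsRegularLocalRing (Localization.AtPrime 𝔮.asIdeal)) :
    ∃ (n' : ℕ) (c' : Fin n' → X₁.presheaf.stalk η),
      Ideal.span (Set.range c') ≠ ⊥ ∧ Ideal.span (Set.range c') ≤ maximalIdeal (X₁.presheaf.stalk η) ∧
      maximalIdeal (X₁.presheaf.stalk η) ≤ (Ideal.span (Set.range c')).radical ∧
      ∀ (j : Fin n') (𝔔 : PrimeSpectrum (blowupAlgebra (Ideal.span (Set.range c')) (c' j))),
        IsRegularLocalRing (Localization.AtPrime 𝔔.asIdeal) ∧ FullCl p (Localization.AtPrime 𝔔.asIdeal) := by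
  classical
  haveI : IsLocallyNoetherian X₁ := LocallyOfFiniteType.isLocallyNoetherian f₁
  -- `S := Spec 𝒪_{X₁,η}`: integral, Noetherian, affine, quasi-excellent, of dimension `3`
  have hqX : Scheme.IsQuasiExcellent X₁ := Scheme.isQuasiExcellent_of_locallyOfFiniteType Stacks07QW_field_holds f₁
  have hqR : IsQuasiExcellentRing (X₁.presheaf.stalk η) := hqX.isQuasiExcellentRing_stalk η
  have hqe : Scheme.IsQuasiExcellent (Spec (.of (X₁.presheaf.stalk η))) :=
    Scheme.isQuasiExcellent_of_locallyOfFiniteType_of_isQuasiExcellentRing Stacks07QU_holds hqR (𝟙 _)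
  have hdimS : topologicalKrullDim (Spec (.of (X₁.presheaf.stalk η))) = 3 := by
    change topologicalKrullDim (PrimeSpectrum (X₁.presheaf.stalk η)) = 3
    rw [PrimeSpectrum.topologicalKrullDim_eq_ringKrullDim, hdim]
  -- the one-blowing-up resolution, supported off the regular locus `U`
  obtain ⟨𝓛, T, ρ, h𝓛, hρ, hTreg, U, hU, h𝓛U, -⟩ :=
    CP2019.exists_isBlowup_isRegular_of_dim_three_of_isQuasiExcellent hG h081R hP hqe hdimS
  -- stalks of `S`: at `x`, the localisation `(𝒪_η)_x`
  have stalk_equiv : ∀ x : Spec (.of (X₁.presheaf.stalk η)),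
      Nonempty (Localization.AtPrime x.asIdeal ≃+* (Spec (.of (X₁.presheaf.stalk η))).presheaf.stalk x) := fun x => by
    letI : Algebra (X₁.presheaf.stalk η) ((Spec (.of (X₁.presheaf.stalk η))).presheaf.stalk x) :=
      inferInstanceAs (Algebra (X₁.presheaf.stalk η) ((Spec.structureSheaf (X₁.presheaf.stalk η)).presheaf.stalk x))
    haveI : IsLocalization.AtPrime ((Spec (.of (X₁.presheaf.stalk η))).presheaf.stalk x) x.asIdeal :=
      inferInstanceAs (IsLocalization.AtPrime ((Spec.structureSheaf (X₁.presheaf.stalk η)).presheaf.stalk x) x.asIdeal)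
    exact ⟨(IsLocalization.algEquiv x.asIdeal.primeCompl (Localization.AtPrime x.asIdeal)
      ((Spec (.of (X₁.presheaf.stalk η))).presheaf.stalk x)).toRingEquiv⟩
  -- every point other than the closed point is regular, i.e. lies in `U`
  have hmemU : ∀ x : Spec (.of (X₁.presheaf.stalk η)), x.asIdeal ≠ maximalIdeal (X₁.presheaf.stalk η) →
      x ∈ (U : Set (Spec (.of (X₁.presheaf.stalk η)))) := by
    intro x hx
    rw [hU, Scheme.mem_regularLocus]
    obtain ⟨e⟩ := stalk_equiv x
    haveI := hreg x hx
    exact IsRegularLocalRing.of_ringEquiv e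
  -- `𝒪_η` is the local ring of `S` at its closed point, which is therefore NOT regular
  have hSnotreg : ¬ Scheme.IsRegular (Spec (.of (X₁.presheaf.stalk η))) := by
    intro hS
    apply hsing
    obtain ⟨e⟩ := stalk_equiv (closedPoint (X₁.presheaf.stalk η))
    haveI : IsRegularLocalRing ((Spec (.of (X₁.presheaf.stalk η))).presheaf.stalk (closedPoint (X₁.presheaf.stalk η))) := hS _
    have e0 : X₁.presheaf.stalk η ≃+* Localization.AtPrime (maximalIdeal (X₁.presheaf.stalk η)) :=
      (IsLocalization.atUnits (S := Localization.AtPrime (maximalIdeal (X₁.presheaf.stalk η)))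
        (X₁.presheaf.stalk η) (maximalIdeal (X₁.presheaf.stalk η)).primeCompl
        (fun a ha => (IsUnit.mem_submonoid_iff a).mpr (IsLocalRing.notMem_maximalIdeal.mp ha))).toRingEquiv
    exact IsRegularLocalRing.of_ringEquiv (e0.trans e).symm
  -- `𝓛 = 𝔮~` for the ideal `𝔮` of its global sections
  let eΓ := Scheme.ΓSpecIso (.of (X₁.presheaf.stalk η))
  let 𝔮 : Ideal (X₁.presheaf.stalk η) := (𝓛.ideal ⟨⊤, isAffineOpen_top _⟩).map eΓ.hom.hom
  have hcomp : eΓ.inv.hom.comp eΓ.hom.hom = RingHom.id _ := by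
    rw [← CommRingCat.hom_comp, Iso.hom_inv_id, CommRingCat.hom_id]
  have h𝔮map : 𝔮.map eΓ.inv.hom = 𝓛.ideal ⟨⊤, isAffineOpen_top _⟩ := by
    rw [Ideal.map_map, hcomp, Ideal.map_id]
  have h𝓛eq : affineBlowup.idealSheaf 𝔮 = 𝓛 := by
    apply Scheme.IdealSheafData.ext_of_isAffine
    rw [affineBlowup.idealSheaf, ideal_ofIdealTop_top, h𝔮map]
  have h𝔮0 : 𝔮 ≠ ⊥ := by
    intro h0
    apply h𝓛
    rw [← h𝓛eq, h0]
    apply Scheme.IdealSheafData.ext_of_isAffine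
    rw [affineBlowup.idealSheaf, ideal_ofIdealTop_top, Ideal.map_bot, Scheme.IdealSheafData.ideal_bot, Pi.bot_apply]
  -- the support of `𝓛` is `V(𝔮)`, and it is contained in `{𝔪_η}`
  have hsupp : ∀ x : Spec (.of (X₁.presheaf.stalk η)),
      x ∈ (𝓛.support : Set (Spec (.of (X₁.presheaf.stalk η)))) ↔ 𝔮 ≤ x.asIdeal := by
    intro x
    rw [← h𝓛eq, affineBlowup.support_idealSheaf]
    exact (PrimeSpectrum.mem_zeroLocus x (𝔮 : Set (X₁.presheaf.stalk η))).trans SetLike.coe_subset_coe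
  have hsupp_closed : ∀ x : Spec (.of (X₁.presheaf.stalk η)),
      x ∈ (𝓛.support : Set (Spec (.of (X₁.presheaf.stalk η)))) → x.asIdeal = maximalIdeal (X₁.presheaf.stalk η) := by
    intro x hx
    by_contra hne
    exact h𝓛U hx (hmemU x hne)
  -- `𝔮 ⊆ 𝔪_η`: otherwise `𝔮 = ⊤`, `𝓛 = ⊤`, `ρ` is an isomorphism and `S` would be regular
  have h𝔮le : 𝔮 ≤ maximalIdeal (X₁.presheaf.stalk η) := by
    by_contra hnot
    have h𝔮top : 𝔮 = ⊤ := by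
      by_contra h
      exact hnot (IsLocalRing.le_maximalIdeal h)
    have h𝓛top : 𝓛 = ⊤ := by
      rw [← Scheme.IdealSheafData.support_eq_bot_iff, eq_bot_iff]
      intro x hx
      have hx' : 𝔮 ≤ x.asIdeal := (hsupp x).mp hx
      rw [h𝔮top, top_le_iff] at hx'
      exact absurd hx' x.2.ne_top
    rw [h𝓛top] at hρ
    obtain ⟨e, -, -⟩ := (isBlowup_id_top (Spec (.of (X₁.presheaf.stalk η)))).unique hρ
    exact hSnotreg (hTreg.of_iso e.inv)
  -- `√𝔮 ⊇ 𝔪_η`: every prime over `𝔮` is a point of `supp 𝓛`, hence the closed point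
  have hrad : maximalIdeal (X₁.presheaf.stalk η) ≤ 𝔮.radical := by
    rw [Ideal.radical_eq_sInf]
    refine le_sInf ?_
    rintro P ⟨hP𝔮, hPprime⟩
    have hP : P = maximalIdeal (X₁.presheaf.stalk η) := hsupp_closed ⟨P, hPprime⟩ ((hsupp ⟨P, hPprime⟩).mpr hP𝔮)
    exact le_of_eq hP.symm
  -- generators `c′` of `𝔮`; the affine blowing up `Bl_{(c′)} S` is a blowing up along `𝓛`, hence regular
  obtain ⟨n', c', hc⟩ := Submodule.fg_iff_exists_fin_generating_family.mp (IsNoetherian.noetherian 𝔮)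
  have hc' : Ideal.span (Set.range c') = 𝔮 := hc
  have hregBl : Scheme.IsRegular (affineBlowup (Ideal.span (Set.range c'))) := by
    have hb : IsBlowup (affineBlowup.π (Ideal.span (Set.range c'))) 𝓛 := by
      rw [← h𝓛eq, ← hc']
      exact affineBlowup.isBlowup _
    obtain ⟨e, -, -⟩ := hρ.unique hb
    exact hTreg.of_iso e.hom
  refine ⟨n', c', by rw [hc']; exact h𝔮0, by rw [hc']; exact h𝔮le, by rw [hc']; exact hrad, fun j 𝔔 => ?_⟩
  -- the prime `𝔔` of the chart `𝒪_η[(c′)/c′_j]` is a point `x′` of the chart `Spec (𝒪_η[(c′)t])_{(c′_j t)} ⊆ Bl_{(c′)} S`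
  have hcj : ∀ j, c' j ∈ Ideal.span (Set.range c') := fun j => Ideal.mem_span_range_self (f := c') (x := j)
  set ε : chartRing c' j ≃+* blowupAlgebra (Ideal.span (Set.range c')) (c' j) :=
    reesChartEquiv (I := Ideal.span (Set.range c')) (c' j) (hcj j) with hεdef
  let w : Spec (.of (chartRing c' j)) :=
    ⟨𝔔.asIdeal.comap (ε : chartRing c' j →+* _), Ideal.comap_isPrime (ε : chartRing c' j →+* _) 𝔔.asIdeal⟩
  have hmemw : ∀ b : chartRing c' j, ε b ∈ 𝔔.asIdeal ↔ b ∈ w.asIdeal := fun b => Iff.rfl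
  haveI : IsIso ((affineBlowup.chartι (I := Ideal.span (Set.range c')) (c' j) (hcj j)).stalkMap w) := inferInstance
  haveI := w.2
  haveI := 𝔔.2
  obtain ⟨e3⟩ := BlowupFiModelOfCover.nonempty_ringEquiv_localization_of_ringEquiv ε w.asIdeal 𝔔.asIdeal hmemw
  have e : (affineBlowup (Ideal.span (Set.range c'))).presheaf.stalk
      ((affineBlowup.chartι (I := Ideal.span (Set.range c')) (c' j) (hcj j)) w) ≃+* Localization.AtPrime 𝔔.asIdeal :=
    ((asIso ((affineBlowup.chartι (I := Ideal.span (Set.range c')) (c' j) (hcj j)).stalkMap w)).commRingCatIsoToRingEquiv.trans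
      (Spec.stalkIso (.of (chartRing c' j)) w).commRingCatIsoToRingEquiv).trans e3
  -- regular, of characteristic `p`, hence FULL
  have hregx : IsRegularLocalRing ((affineBlowup (Ideal.span (Set.range c'))).presheaf.stalk
      ((affineBlowup.chartι (I := Ideal.span (Set.range c')) (c' j) (hcj j)) w)) := hregBl _
  have hreg𝔔 : IsRegularLocalRing (Localization.AtPrime 𝔔.asIdeal) := by
    haveI := hregx
    exact IsRegularLocalRing.of_ringEquiv e
  haveI : CharP (Localization.AtPrime 𝔔.asIdeal) p :=
    CharP.of_ringHom_of_ne_zero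
      ((algebraMap (blowupAlgebra (Ideal.span (Set.range c')) (c' j)) (Localization.AtPrime 𝔔.asIdeal)).comp
        ((algebraMap (X₁.presheaf.stalk η) (blowupAlgebra (Ideal.span (Set.range c')) (c' j))).comp
          ((X₁.presheaf.germ ⊤ η trivial).hom.comp (f₁.appTop.hom.comp (Scheme.ΓSpecIso (.of k)).inv.hom))))
      p hp.out.ne_zero
  haveI := hreg𝔔
  exact ⟨hreg𝔔, FiClauseOfRegular.stub_fiClauseOfRegular p _⟩

/-- The same with the hypothesis at the PROPER GENERIZATIONS of `η` in `X₁` (scheme-level currency of res-L1-w45a-tri-2's note (α):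
`x ⤳ η`, `x ≠ η` ⇒ `𝒪_{X₁,x}` regular). [OURS · conditional-result] [cite: CossartPiltant2019, Thm. 1.1 (i)(ii); Prop. 4.4] -/
theorem exists_primaryRegularLocFix_of_isolated'
    (hG : CossartPiltant2019General.{0}) (h081R : Stacks081R.{0}) (hP : CossartPiltant2019Principalization.{0})
    (p : ℕ) [Fact p.Prime] {k : Type} [Field k] [CharP k p] {X₁ : Scheme.{0}} (f₁ : X₁ ⟶ Spec (.of k))
    [LocallyOfFiniteType f₁] [IsIntegral X₁]
    (η : X₁) (hdim : ringKrullDim (X₁.presheaf.stalk η) = 3) (hsing : ¬ IsRegularLocalRing (X₁.presheaf.stalk η))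
    (hreg : ∀ x : X₁, x ⤳ η → x ≠ η → IsRegularLocalRing (X₁.presheaf.stalk x)) :
    ∃ (n' : ℕ) (c' : Fin n' → X₁.presheaf.stalk η),
      Ideal.span (Set.range c') ≠ ⊥ ∧ Ideal.span (Set.range c') ≤ maximalIdeal (X₁.presheaf.stalk η) ∧
      maximalIdeal (X₁.presheaf.stalk η) ≤ (Ideal.span (Set.range c')).radical ∧
      ∀ (j : Fin n') (𝔔 : PrimeSpectrum (blowupAlgebra (Ideal.span (Set.range c')) (c' j))),
        IsRegularLocalRing (Localization.AtPrime 𝔔.asIdeal) ∧ FullCl p (Localization.AtPrime 𝔔.asIdeal) :=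
  exists_primaryRegularLocFix_of_isolated hG h081R hP p f₁ η hdim hsing (isRegularLocalRing_atPrime_of_generizations η hreg)

end Summit.ResolutionOfSingularities.ResolutionOfSingularities.Theorems.FInjectiveMacaulayfication.PrimaryRegularLocFixOfIsolated

end
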